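import Literature.Algebra.EuclideanLattices.SmoothingParameterBounds
import Literature.Algebra.EuclideanLattices.SuccessiveMinimaProofs
import Literature.Algebra.EuclideanLattices.IntegerBases
import HarnessLib

/-!
# Deciding `GapSVP` from a short linearly independent set of dual vectors (transference)

Topic `Algebra/EuclideanLattices` (family `pqc`). Fully PROVED geometric core of an alternative,
verifier-free route from Micciancio–Regev's worst-case/average-case machinery to the decision problem
`GapSVP_γ` for POLYNOMIAL (not optimal) factors, written for the decomposition of the named fact
`Literature.Computability.Cryptography.owfExist_of_gapSVP_worstCaseHard` (`Cryptography/LatticeOWF.lean`),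
whose hypothesis quantifies over ALL polynomially bounded factors `γ`.

Micciancio–Regev 2007 prove Thm. 5.23 (`GapCVP′_γ → SIS′`, `γ = 14π√n β`) by first computing, with
their Corollary 5.13 and the SIS′ oracle, a set `S` of `n` linearly independent vectors of the dual
lattice `L(B)*` with `‖S‖ ≤ 8β√n η_ε(L(B)*)`, `ε = 2⁻ⁿ` (authors' version p. 29, first step of the
proof), and then running the Aharonov–Regev verifier on dual samples (§5.4). If one is content with
the factor `γ = 8βn` instead of `14π√n β`, the first step alone already decides `GapSVP_γ`, by the
two elementary estimates proved here (`L` a full-rank lattice in dimension `n ≥ 1`,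
`s₁, …, s_k ∈ L*` spanning the space):

* `exists_one_le_minNorm_mul_norm` — **easy half of transference**: `1 ≤ λ₁(L) · maxᵢ ‖sᵢ‖`
  (a shortest `v ∈ L ∖ {0}` has `⟨sᵢ, v⟩ ∈ ℤ` for all `i` and `⟨sᵢ, v⟩ ≠ 0` for some `i`, so
  `1 ≤ |⟨sᵢ, v⟩| ≤ ‖sᵢ‖ ‖v‖`; Banaszczyk 1993, (1.?) `λ₁(L)λₙ(L*) ≥ 1`, the trivial direction;
  Micciancio–Goldwasser 2002, Ch. 7/8; cf. the tree's `minNorm_mul_minNorm_dualLattice_le_one`);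
* `norm_mul_minNorm_le_of_le_smoothing` — with **MR07 Lemma 3.2** (`η_{2⁻ⁿ}(L*) ≤ √n/λ₁(L)`, tree:
  `smoothingParameter_two_pow_neg_le_holds` applied to `L*`, `L** = L`): if `‖x‖ ≤ g η_{2⁻ⁿ}(L*)` then
  `‖x‖ λ₁(L) ≤ g √n`.

Hence (`one_le_mul_norm_of_minNorm_le`, `mul_norm_lt_one_of_lt_minNorm`): on a YES instance
(`λ₁(L) ≤ d`) every such dual set has `d ‖sᵢ‖ ≥ 1` for some `i`, while on a NO instance
(`λ₁(L) > γ d` with `γ ≥ g√n`) a dual set with `‖sᵢ‖ ≤ g η_{2⁻ⁿ}(L*)` has `d ‖sᵢ‖ < 1` for all `i`: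
the exact rational test "`maxᵢ d² ‖sᵢ‖² ≥ 1`" separates the two cases. With `g = 8β√n` (Cor. 5.13)
this is the factor `γ = 8βn`. Theorems only, no definitions; Mathlib + the tree's lattice prelude.

## References

* D. Micciancio, O. Regev, *Worst-case to average-case reductions based on Gaussian measures*,
  SIAM J. Comput. 37 (2007) 267–302; authors' version: Lemma 3.2 (p. 11), Cor. 5.13 (p. 25),
  proof of Thm. 5.23, first step (p. 29) (`lit read doi:10.1137/S0097539705447360`).
* W. Banaszczyk, *New bounds in some transference theorems in the geometry of numbers*, Math. Ann.
  296 (1993) 625–635, §2 (transference `1 ≤ λ₁(L)λₙ(L*) ≤ n`).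
* D. Micciancio, S. Goldwasser, *Complexity of Lattice Problems*, Kluwer 2002, Ch. 7 (transference
  bounds), Ch. 8 (Ajtai's connection).
-/

noncomputable section

open Module
open scoped InnerProductSpace

namespace Literature.Algebra.EuclideanLattices

variable {E : Type*} [NormedAddCommGroup E] [InnerProductSpace ℝ E]

/-- **Integrality forces a unit of correlation.** If `v ≠ 0` lies in `L` and the dual vectors
`sᵢ ∈ L*` span the ambient space over `ℝ`, then `1 ≤ ‖sᵢ‖ · ‖v‖` for some `i`: otherwise every
integer `⟨sᵢ, v⟩` has absolute value `< 1`, hence vanishes, and `v` is orthogonal to a spanning set.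
[Banaszczyk 1993, §2 (trivial half of transference); Micciancio–Goldwasser 2002, Ch. 7] [cite: Banaszczyk1993, §2 (trivial inequality λ₁(L)λₙ(L*) ≥ 1)] -/
theorem exists_one_le_norm_mul_norm_of_span_eq_top {ι : Type*} {L : Submodule ℤ E} {s : ι → E}
    (hs : ∀ i, s i ∈ dualLattice L) (hspan : Submodule.span ℝ (Set.range s) = ⊤) {v : E}
    (hv : v ∈ L) (hv0 : v ≠ 0) : ∃ i, 1 ≤ ‖s i‖ * ‖v‖ := by
  by_contra h
  push Not at h
  -- every `⟨sᵢ, v⟩` is an integer of absolute value `< 1`, hence `0`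
  have hzero : ∀ i, ⟪s i, v⟫_ℝ = 0 := fun i => by
    obtain ⟨k, hk⟩ := mem_dualLattice.1 (hs i) v hv
    have habs : |(k : ℝ)| < 1 := by
      rw [hk]
      exact (abs_real_inner_le_norm _ _).trans_lt (h i)
    have hk0 : k = 0 := by
      have h1 : |k| < 1 := by exact_mod_cast habs
      rw [abs_lt] at h1
      omega
    rw [← hk, hk0, Int.cast_zero]
  -- so `v` is orthogonal to the span of the `sᵢ`, which is everything
  have horth : ∀ x ∈ Submodule.span ℝ (Set.range s), ⟪x, v⟫_ℝ = 0 := by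
    intro x hx
    induction hx using Submodule.span_induction with
    | mem x hx =>
        obtain ⟨i, rfl⟩ := hx
        exact hzero i
    | zero => exact inner_zero_left _
    | add x y _ _ hx hy => rw [inner_add_left, hx, hy, add_zero]
    | smul a x _ hx => rw [inner_smul_left, hx, mul_zero]
  have hvv : ⟪v, v⟫_ℝ = 0 := horth v (by rw [hspan]; trivial)
  exact hv0 (inner_self_eq_zero.mp hvv)

/-! ### Specialisation to integer lattice instances (`E = ℝⁿ`, `n = I.n`) and scaled dual vectors

The reduction outputs dual vectors as integer vectors `uᵢ` over a common denominator `D ≥ 1`,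
`sᵢ = uᵢ/D`; the test `1 ≤ d ‖sᵢ‖` for `d = a/b` reads `D² b² ≤ a² ‖uᵢ‖²` in integers. -/

/-- Squared-norm form of the threshold: for `D, b > 0`, `1 ≤ (a/b) ‖u/D‖ ↔ D² b² ≤ a² ‖u‖²`
(both sides nonnegative, `a ≥ 0`). [folklore] -/
theorem one_le_div_mul_norm_smul_iff {u : E} {a b D : ℝ} (ha : 0 ≤ a) (hb : 0 < b) (hD : 0 < D) :
    1 ≤ a / b * ‖D⁻¹ • u‖ ↔ D ^ 2 * b ^ 2 ≤ a ^ 2 * ‖u‖ ^ 2 := by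
  rw [norm_smul, norm_inv, Real.norm_of_nonneg hD.le]
  have hbD : 0 < b * D := mul_pos hb hD
  have key : a / b * (D⁻¹ * ‖u‖) = a * ‖u‖ / (b * D) := by
    field_simp
  rw [key, le_div_iff₀ hbD, one_mul]
  constructor
  · intro h
    have h' : (b * D) ^ 2 ≤ (a * ‖u‖) ^ 2 := pow_le_pow_left₀ hbD.le h 2
    nlinarith [h']
  · intro h
    have h0 : 0 ≤ a * ‖u‖ := mul_nonneg ha (norm_nonneg _)
    nlinarith [sq_nonneg (b * D - a * ‖u‖), sq_nonneg (b * D + a * ‖u‖), mul_pos hbD hbD]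

variable [FiniteDimensional ℝ E]

/-- **Easy half of transference, `λ₁` form.** For a full-rank lattice `L` in a space of positive
dimension and dual vectors `sᵢ ∈ L*` spanning the space, `1 ≤ λ₁(L) · ‖sᵢ‖` for some `i` (apply the
previous lemma to a shortest nonzero vector, which exists: `exists_mem_norm_eq_minNorm_holds`). In
particular `λₙ(L*) ≥ 1/λ₁(L)`. [Banaszczyk 1993, §2; Micciancio–Goldwasser 2002, Ch. 7] [cite: Banaszczyk1993, §2 (trivial inequality λ₁(L)λₙ(L*) ≥ 1)] -/
theorem exists_one_le_minNorm_mul_norm [Nontrivial E] {ι : Type*} (L : Submodule ℤ E)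
    [DiscreteTopology L] [IsZLattice ℝ L] {s : ι → E} (hs : ∀ i, s i ∈ dualLattice L)
    (hspan : Submodule.span ℝ (Set.range s) = ⊤) : ∃ i, 1 ≤ minNorm L * ‖s i‖ := by
  have hL : L ≠ ⊥ := by
    intro h
    have htop : Submodule.span ℝ ((L : Submodule ℤ E) : Set E) = ⊤ := IsZLattice.span_top
    rw [h, Submodule.bot_coe, Submodule.span_zero_singleton] at htop
    exact bot_ne_top htop
  obtain ⟨v, hvL, hv0, hvnorm⟩ := exists_mem_norm_eq_minNorm_holds L hL
  obtain ⟨i, hi⟩ := exists_one_le_norm_mul_norm_of_span_eq_top hs hspan hvL hv0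
  exact ⟨i, by rwa [← hvnorm, mul_comm]⟩

/-- **The NO side: short relative to the smoothing parameter of the dual means short relative to
`1/λ₁`.** For a full-rank lattice `L` in dimension `n ≥ 1` and `g ≥ 0`: if `‖x‖ ≤ g · η_{2⁻ⁿ}(L*)`
then `‖x‖ · λ₁(L) ≤ g √n`, by Micciancio–Regev's Lemma 3.2 for the dual lattice,
`η_{2⁻ⁿ}(L*) ≤ √n/λ₁(L**) = √n/λ₁(L)` (tree: `smoothingParameter_two_pow_neg_le_holds`,
`dualLattice_dualLattice`). [cite: MicciancioRegev2007, Lemma 3.2 (with eq. (15), proof of Thm. 5.23 p. 29)] -/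
theorem norm_mul_minNorm_le_of_le_smoothing [Nontrivial E] (L : Submodule ℤ E) [DiscreteTopology L]
    [IsZLattice ℝ L] {x : E} {g : ℝ} (hg : 0 ≤ g)
    (hx : ‖x‖ ≤ g * smoothingParameter (dualLattice L) ((2⁻¹ : ℝ) ^ finrank ℝ E)) :
    ‖x‖ * minNorm L ≤ g * Real.sqrt (finrank ℝ E) := by
  have hL : L ≠ ⊥ := by
    intro h
    have htop : Submodule.span ℝ ((L : Submodule ℤ E) : Set E) = ⊤ := IsZLattice.span_top
    rw [h, Submodule.bot_coe, Submodule.span_zero_singleton] at htop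
    exact bot_ne_top htop
  have hlam : 0 < minNorm L := minNorm_pos_of_ne_bot L hL
  have h32 : smoothingParameter (dualLattice L) ((2⁻¹ : ℝ) ^ finrank ℝ E) ≤
      Real.sqrt (finrank ℝ E) / minNorm L := by
    have h := smoothingParameter_two_pow_neg_le_holds (dualLattice L)
    unfold smoothingParameter_two_pow_neg_le at h
    rwa [dualLattice_dualLattice] at h
  calc ‖x‖ * minNorm L ≤ g * (Real.sqrt (finrank ℝ E) / minNorm L) * minNorm L := by
        gcongr
        exact hx.trans (mul_le_mul_of_nonneg_left h32 hg)
    _ = g * Real.sqrt (finrank ℝ E) := by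
        field_simp

/-- **YES instances pass the test.** If `λ₁(L) ≤ d` (a YES instance of `GapSVP`) and the dual vectors
`sᵢ ∈ L*` span the space, then `1 ≤ d ‖sᵢ‖` for some `i`. [cite: MicciancioRegev2007, proof of Thm. 5.23 (first step, p. 29) with Banaszczyk1993 §2] -/
theorem one_le_mul_norm_of_minNorm_le [Nontrivial E] {ι : Type*} (L : Submodule ℤ E)
    [DiscreteTopology L] [IsZLattice ℝ L] {s : ι → E} (hs : ∀ i, s i ∈ dualLattice L)
    (hspan : Submodule.span ℝ (Set.range s) = ⊤) {d : ℝ} (hd : minNorm L ≤ d) :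
    ∃ i, 1 ≤ d * ‖s i‖ := by
  obtain ⟨i, hi⟩ := exists_one_le_minNorm_mul_norm L hs hspan
  exact ⟨i, hi.trans (mul_le_mul_of_nonneg_right hd (norm_nonneg _))⟩

/-- **NO instances fail the test.** If `γ d < λ₁(L)` (a NO instance of `GapSVP_γ`), `0 ≤ d`,
`g √n ≤ γ` with `g ≥ 0`, and `‖sᵢ‖ ≤ g η_{2⁻ⁿ}(L*)` for all `i`, then `d ‖sᵢ‖ < 1` for all `i`.
With `g = 8β√n` (Micciancio–Regev Cor. 5.13 applied to `L*`) this is the factor `γ = 8βn`.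
[cite: MicciancioRegev2007, Lemma 3.2 and Cor. 5.13 (proof of Thm. 5.23, first step, p. 29)] -/
theorem mul_norm_lt_one_of_lt_minNorm [Nontrivial E] {ι : Type*} (L : Submodule ℤ E)
    [DiscreteTopology L] [IsZLattice ℝ L] {s : ι → E} {g γ d : ℝ} (hg : 0 ≤ g) (hd : 0 ≤ d)
    (hγ : g * Real.sqrt (finrank ℝ E) ≤ γ) (hno : γ * d < minNorm L)
    (hbound : ∀ i, ‖s i‖ ≤ g * smoothingParameter (dualLattice L) ((2⁻¹ : ℝ) ^ finrank ℝ E))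
    (i : ι) : d * ‖s i‖ < 1 := by
  have hL : L ≠ ⊥ := by
    intro h
    have htop : Submodule.span ℝ ((L : Submodule ℤ E) : Set E) = ⊤ := IsZLattice.span_top
    rw [h, Submodule.bot_coe, Submodule.span_zero_singleton] at htop
    exact bot_ne_top htop
  have hlam : 0 < minNorm L := minNorm_pos_of_ne_bot L hL
  have h1 : ‖s i‖ * minNorm L ≤ γ := (norm_mul_minNorm_le_of_le_smoothing L hg (hbound i)).trans hγ
  -- `d ‖sᵢ‖ λ₁ ≤ d γ < λ₁`
  have h2 : d * ‖s i‖ * minNorm L < 1 * minNorm L := by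
    calc d * ‖s i‖ * minNorm L = d * (‖s i‖ * minNorm L) := by ring
      _ ≤ d * γ := mul_le_mul_of_nonneg_left h1 hd
      _ = γ * d := mul_comm _ _
      _ < minNorm L := hno
      _ = 1 * minNorm L := (one_mul _).symm
  exact lt_of_mul_lt_mul_right h2 hlam.le

namespace LatticeInstance

/-- **YES instances of `GapSVP` pass the dual-set test** (integer form). Let `B` be a nonsingular
integer basis of dimension `n ≥ 1` with `λ₁(L(B)) ≤ d`, `d = a/b > 0`. If `u₁, …, u_k ∈ ℤⁿ` and
`D ≥ 1` are such that the `uᵢ/D` lie in `L(B)*` and span `ℝⁿ`, then `D² b² ≤ a² ‖uᵢ‖²` for some `i`.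
[cite: MicciancioRegev2007, proof of Thm. 5.23 (first step, p. 29) with Banaszczyk1993 §2] -/
theorem gapSVP_dualTest_of_yes {I : LatticeInstance} (hI : I.IsNonsingular) (hn : 1 ≤ I.n) {ι : Type*}
    {u : ι → Fin I.n → ℤ} {D : ℕ} (hD : 0 < D)
    (hmem : ∀ i, (D : ℝ)⁻¹ • intVecToEuclidean I.n (u i) ∈ dualLattice I.lattice)
    (hspan : Submodule.span ℝ (Set.range fun i => intVecToEuclidean I.n (u i)) = ⊤)
    {a : ℤ} {b : ℕ} (ha : 0 ≤ a) (hb : 0 < b) (hyes : minNorm I.lattice ≤ (a : ℝ) / b) :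
    ∃ i, (D : ℝ) ^ 2 * (b : ℝ) ^ 2 ≤ (a : ℝ) ^ 2 * ‖intVecToEuclidean I.n (u i)‖ ^ 2 := by
  haveI : IsZLattice ℝ I.lattice := isZLattice_of_isNonsingular hI
  haveI : Nontrivial (EuclideanSpace ℝ (Fin I.n)) := by
    haveI : Nonempty (Fin I.n) := ⟨⟨0, hn⟩⟩
    infer_instance
  have hspan' : Submodule.span ℝ (Set.range fun i => (D : ℝ)⁻¹ • intVecToEuclidean I.n (u i)) = ⊤ := by
    have hD0 : (D : ℝ)⁻¹ ≠ 0 := inv_ne_zero (by exact_mod_cast hD.ne')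
    rw [← hspan]
    apply le_antisymm
    · refine Submodule.span_le.2 ?_
      rintro _ ⟨i, rfl⟩
      exact Submodule.smul_mem _ _ (Submodule.subset_span ⟨i, rfl⟩)
    · refine Submodule.span_le.2 ?_
      rintro _ ⟨i, rfl⟩
      have : intVecToEuclidean I.n (u i) = (D : ℝ) • ((D : ℝ)⁻¹ • intVecToEuclidean I.n (u i)) := by
        rw [smul_smul, mul_inv_cancel₀ (by exact_mod_cast hD.ne'), one_smul]
      change intVecToEuclidean I.n (u i) ∈ _
      rw [this]
      exact Submodule.smul_mem _ _ (Submodule.subset_span ⟨i, rfl⟩)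
  obtain ⟨i, hi⟩ := one_le_mul_norm_of_minNorm_le I.lattice hmem hspan' hyes
  refine ⟨i, (one_le_div_mul_norm_smul_iff (by exact_mod_cast ha) (by exact_mod_cast hb)
    (by exact_mod_cast hD)).1 hi⟩

/-- **NO instances of `GapSVP_γ` fail the dual-set test** (integer form). Let `B` be a nonsingular
integer basis of dimension `n ≥ 1` with `γ d < λ₁(L(B))`, `d = a/b > 0`, and `g √n ≤ γ`, `g ≥ 0`. If
`‖uᵢ/D‖ ≤ g η_{2⁻ⁿ}(L(B)*)` for all `i` (`D ≥ 1`), then `a² ‖uᵢ‖² < D² b²` for all `i`.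
[cite: MicciancioRegev2007, Lemma 3.2 and Cor. 5.13 (proof of Thm. 5.23, first step, p. 29)] -/
theorem gapSVP_dualTest_of_no {I : LatticeInstance} (hI : I.IsNonsingular) (hn : 1 ≤ I.n) {ι : Type*}
    {u : ι → Fin I.n → ℤ} {D : ℕ} (hD : 0 < D) {g γ : ℝ} (hg : 0 ≤ g)
    (hγ : g * Real.sqrt I.n ≤ γ)
    (hbound : ∀ i, ‖(D : ℝ)⁻¹ • intVecToEuclidean I.n (u i)‖ ≤
      g * smoothingParameter (dualLattice I.lattice) ((2⁻¹ : ℝ) ^ I.n))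
    {a : ℤ} {b : ℕ} (ha : 0 ≤ a) (hb : 0 < b) (hno : γ * ((a : ℝ) / b) < minNorm I.lattice) (i : ι) :
    (a : ℝ) ^ 2 * ‖intVecToEuclidean I.n (u i)‖ ^ 2 < (D : ℝ) ^ 2 * (b : ℝ) ^ 2 := by
  haveI : IsZLattice ℝ I.lattice := isZLattice_of_isNonsingular hI
  haveI : Nontrivial (EuclideanSpace ℝ (Fin I.n)) := by
    haveI : Nonempty (Fin I.n) := ⟨⟨0, hn⟩⟩
    infer_instance
  have hd : 0 ≤ (a : ℝ) / b := div_nonneg (by exact_mod_cast ha) (by positivity)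
  have hlt := mul_norm_lt_one_of_lt_minNorm I.lattice hg hd (by rwa [finrank_euclideanSpace_fin])
    hno (fun j => by rw [finrank_euclideanSpace_fin]; exact hbound j) i
  by_contra hle
  push Not at hle
  exact (lt_irrefl (1 : ℝ)) (lt_of_le_of_lt ((one_le_div_mul_norm_smul_iff (by exact_mod_cast ha)
    (by exact_mod_cast hb) (by exact_mod_cast hD)).2 hle) hlt)

end LatticeInstance

end Literature.Algebra.EuclideanLattices

end
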